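import Summits.BirchSwinnertonDyer.BirchSwinnertonDyer.Theses.EisensteinPrimes
import Literature.NumberTheory.EllipticCurves.SkinnerUrban2014.SemistableCurvesProofs
import HarnessLib

/-!
# Crux 3 `MazurMCOnCellB` (stmt-BirchSwinnertonDyer-19033) — the SEMISTABLE SLICE of the crux, read from the kernel
# theorems of cell `b2b-bsdres` (`Partition/SemistableEisenstein.lean`, `SkinnerUrban2014/SemistableCurvesProofs.lean`):
# semistable X2b pairs live at `p ∈ {3, 5, 7}`, are SPLIT at `p` and carry a rational `p`-torsion point in the isogeny
# class; the `p = 13` slice of the crux and every NON-split X2b pair are supported on NON-semistable curves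

Width seat bsd-line-x2-p1-w6 (gen 8), cell `bsd-eis` (run/shared/lean/pub/bsd-eis/), 2026-08-29;
`--supports stmt-BirchSwinnertonDyer-19033 --as helper`. THEOREMS ONLY (no `def`, no named fact introduced, no `sorry`,
no instance). The registered line `twistback` v12 (sha256 `540948e0…`, HELD, LEAD g16 verdict «promote-stub FINAL FORM»)
is NOT touched: like x2-p1-w8 g7's `…PrimeSupport` (the crux is the conjunction of its slices at `p = 3, 5, 7, 13`) this
file is bookkeeping on the POPULATION the crux `∀ W p, X2.CellB W p → X2.MazurMainConjectureAt W p` quantifies over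
(`X2.CellB W p := r_an = 0 ∧ ClassX2 W p ∧ ¬ GVPar W p`, `ClassX2 W p := p ≠ 2 ∧ Red W p ∧ Mult W p`).

WHAT. Serre's Prop. 21 (Invent. Math. 15 (1972) §5.4; Edixhoven 1997 Prop. 2.1, PROVED in the tree) and Mazur's torsion
theorem are ALREADY kernel theorems of cell `b2b-bsdres` in exactly the shape crux 3 needs, but had not been read on
`X2.CellB` / the route's decls (rg over `Summits/BirchSwinnertonDyer/BirchSwinnertonDyer`: no user; the x2-p1 lineage's
verdicts g8–g18 and `Cruxes/MazurMCOnCellB/STRATEGY-CENSUS.md` do not cite them):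
`Rank1Residual.exists_addOrderOf_eq_or_isogenous_of_semistable_of_red` (semistable, `E[p]` reducible ⟹ `W(ℚ)` or a
`ℚ`-isogenous globally minimal `W'(ℚ)` has a point of order `p`), `X2.hasSplitMultiplicativeReductionAtPrime_of_semistable_of_classX2`
(every `p`), `X2.not_semistable_of_classX2_of_not_split`, `X2.cellB_of_semistable_of_classX2_of_analyticRank_eq_zero`
(semistable X2 pairs are X2b, never X2a), and `SkinnerUrban2014.irr_of_semistable_of_eleven_le` (Mazur 1978 Thm. 4:
semistable, `p ≥ 11` ⟹ `E[p]` irreducible, granted `mazur_torsion`). This file states their consequences for the crux: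

* §1 `not_classX2_of_semistable_of_eleven_le` (the X2 twin of `Rank1Residual.not_classX1_of_semistable_of_eleven_le`),
  **`eq_or_of_cellB_of_semistable`** — a SEMISTABLE X2b pair has `p = 3 ∨ p = 5 ∨ p = 7` —,
  **`not_semistable_of_cellB_of_seven_lt`** / `not_semistable_of_cellB_thirteen` — the `p = 13` slice of x2-p1-w8 g7's
  prime support `{3, 5, 7, 13}` has NO semistable pair: every X2b pair at `13` has an additive prime (the slice is not
  empty in general — on `X₀(13)`, genus `0`, `j = (t²+5t+13)(t⁴+7t³+20t²+19t+1)³/t` has `v₁₃(j) < 0` whenever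
  `v₁₃(t) ≥ 2` or `< 0` — but void for `N ≤ 5·10⁵`, x2-p1-w5 g6 census 07:05:32Z) — all granted `mazur_torsion` BY NAME
  (`hMT`, as in `PastenShimura2024_…_of_mazur_torsion`; bsd.S05, reduced in the tree to printed leaves).
* §2 `mazurMCOnCellB_iff_semistable_slices` — **the crux ⟺ (its slice on SEMISTABLE pairs, where `p ∈ {3, 5, 7}` may be
  assumed) ∧ (its slice on NON-semistable pairs)**, granted `hMT`; `slice_thirteen_iff_nonSemistable`. The semistable slice
  is, UNCONDITIONALLY and by the b2b-bsdres theorems named above (module `Partition.SemistableEisenstein`, not imported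
  here), SPLIT at `p` with a RATIONAL `p`-TORSION point in the isogeny class — at `p = 5, 7` it sits inside the «rational
  `p`-torsion member» population TYPE of x2-p1-w8 g6's (Z) class atlas (225 / 10 tabulated classes), and x2-p1-w5 g6's
  torsion-free classes (139 + 23) are all non-semistable —, while the non-semistable slice contains every NON-split
  X2b pair at every `p` (`X2.not_semistable_of_classX2_of_not_split`; x2-p1-w3 g10's `not_semistable_of_cellB_three_of_not_split`
  is `p = 3`): sub-populations (ii) «non-split, `c(E) ≠ 1`» and (iii) «non-split, `p ≥ 5`» of the LEAD g16 verdict §3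
  are non-semistable class-wide (why the field supply `…TwistbackFieldSupplyDefs.HeegnerFieldWithBernoulliUnit` of
  (iii) always carries the finer ramified condition at additive primes, memo FIELD-SUPPLY-LIT-w5g2).

HONEST FRAMING: one-line readings of existing kernel theorems, conditional on Mazur's torsion theorem BY NAME
(`hMT : ∀ V, mazur_torsion V`; every `⟹` from the crux is unconditional). Closes no registered stub; no summit statement, no case of Mazur's main conjecture and no case of BSD
is proved here; 0 cells / labels / tiers move. References: [SerreInventiones1972] §5.4 Prop. 21; [Edixhoven1997]
Prop. 2.1; [Mazur1977] Thm. 8; [Mazur1978] Thm. 1, Thm. 4; [SilvermanAEC2009] III.4.12, VII.5.1.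
-/

set_option autoImplicit false
-- `Summit.BirchSwinnertonDyer.BirchSwinnertonDyer.…`: the summit and its single sub-problem share a name.
set_option linter.dupNamespace false

noncomputable section

open WeierstrassCurve Literature.NumberTheory.EllipticCurves Literature.NumberTheory.EllipticCurves.Rank1Residual
  Summit.BirchSwinnertonDyer.Rank1Residual
  Summit.BirchSwinnertonDyer.BirchSwinnertonDyer.Theses

namespace Summit.BirchSwinnertonDyer.BirchSwinnertonDyer.Theorems.EisensteinPrimesMazurMCOnCellBSemistableSlice

variable {W : WeierstrassCurve ℚ} [W.IsElliptic] {p : ℕ} [hp : Fact p.Prime]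

/-! ## §1. Semistable X2 / X2b pairs live at `p ∈ {3, 5, 7}` (granted Mazur's torsion theorem) -/

/-- **On a semistable curve class X2 is EMPTY at `p ≥ 11`** (the X2 twin of
`Rank1Residual.not_classX1_of_semistable_of_eleven_le`): X2 asks `E[p]` reducible, but Mazur 1978 Thm. 4 (granted
`mazur_torsion`, tree theorem `SkinnerUrban2014.irr_of_semistable_of_eleven_le`) makes it irreducible.
[cite: Mazur1978, Thm. 4 (p. 131)] [cite: Mazur1977, Thm 8] -/
theorem not_classX2_of_semistable_of_eleven_le (hMT : ∀ V : WeierstrassCurve ℚ, mazur_torsion V)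
    (hsst : Semistable W) (h11 : 11 ≤ p) : ¬ ClassX2 W p :=
  fun h ↦ h.2.1 (SkinnerUrban2014.irr_of_semistable_of_eleven_le W p hMT hsst h11)

/-- **A SEMISTABLE X2 pair has `p = 3 ∨ p = 5 ∨ p = 7`** (granted `mazur_torsion`): `p ≠ 2` by `ClassX2`, `p ≤ 10` by
`not_classX2_of_semistable_of_eleven_le`, `p` prime. [cite: SerreInventiones1972, §5.4 Prop. 21]
[cite: Mazur1978, Thm. 4 (p. 131)] -/
theorem eq_or_of_classX2_of_semistable (hMT : ∀ V : WeierstrassCurve ℚ, mazur_torsion V) (hsst : Semistable W)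
    (hX : ClassX2 W p) : p = 3 ∨ p = 5 ∨ p = 7 := by
  have hpp : p.Prime := hp.out
  have h2 : p ≠ 2 := hX.1
  have h10 : p < 11 := not_le.mp fun h11 ↦ not_classX2_of_semistable_of_eleven_le hMT hsst h11 hX
  have h2' : 2 ≤ p := hpp.two_le
  interval_cases p
  all_goals first
    | exact Or.inl rfl | exact Or.inr (Or.inl rfl) | exact Or.inr (Or.inr rfl) | exact absurd rfl h2
    | exact absurd hpp (by decide)

/-- **A SEMISTABLE X2b pair has `p = 3 ∨ p = 5 ∨ p = 7`** (granted `mazur_torsion`).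
[cite: SerreInventiones1972, §5.4 Prop. 21] [cite: Mazur1978, Thm. 4 (p. 131)] -/
theorem eq_or_of_cellB_of_semistable (hMT : ∀ V : WeierstrassCurve ℚ, mazur_torsion V) (hsst : Semistable W)
    (hc : X2.CellB W p) : p = 3 ∨ p = 5 ∨ p = 7 :=
  eq_or_of_classX2_of_semistable hMT hsst hc.2.1

/-- **An X2b pair at a prime `p > 7` is NOT semistable** (granted `mazur_torsion`): the curve has an additive prime.
[cite: SerreInventiones1972, §5.4 Prop. 21] [cite: Mazur1978, Thm. 4 (p. 131)] -/
theorem not_semistable_of_cellB_of_seven_lt (hMT : ∀ V : WeierstrassCurve ℚ, mazur_torsion V) (hc : X2.CellB W p)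
    (h7 : 7 < p) : ¬ Semistable W := by
  intro hsst
  rcases eq_or_of_cellB_of_semistable hMT hsst hc with h | h | h <;> omega

/-- **The `p = 13` slice of crux 3 has no semistable pair**: `X2.CellB W 13 → ¬ Semistable W` (granted `mazur_torsion`).
Every curve over `ℚ` with a rational `13`-isogeny and multiplicative reduction at `13` has additive reduction somewhere.
[cite: SerreInventiones1972, §5.4 Prop. 21] [cite: Mazur1978, Thm. 1 and Thm. 4] -/
theorem not_semistable_of_cellB_thirteen [Fact (Nat.Prime 13)] (hMT : ∀ V : WeierstrassCurve ℚ, mazur_torsion V)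
    (hc : X2.CellB W 13) : ¬ Semistable W :=
  not_semistable_of_cellB_of_seven_lt hMT hc (by norm_num)

/-! ## §2. The crux split into its semistable and non-semistable slices -/

/-- **Crux 3 ⟺ (its slice on SEMISTABLE pairs — where one may assume `p ∈ {3, 5, 7}`) ∧ (its slice on NON-semistable
pairs)**, granted `mazur_torsion` (`⟹` unconditional). Bookkeeping for a LEAD who would re-line the crux by sub-population:
the semistable slice is split at `p` with a rational `p`-torsion point in the class
(`X2.hasSplitMultiplicativeReductionAtPrime_of_semistable_of_classX2`,
`Rank1Residual.exists_addOrderOf_eq_or_isogenous_of_semistable_of_red`, cell b2b-bsdres), the non-semistable slice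
contains every non-split pair and the whole `p = 13` slice (§1). [cite: SerreInventiones1972, §5.4 Prop. 21]
[cite: Mazur1978, Thm. 4 (p. 131)] -/
theorem mazurMCOnCellB_iff_semistable_slices (hMT : ∀ V : WeierstrassCurve ℚ, mazur_torsion V) :
    EisensteinPrimes.MazurMCOnCellB ↔
      ((∀ (W : WeierstrassCurve ℚ) [W.IsElliptic] [W.IsGloballyMinimal] (p : ℕ) [Fact p.Prime],
          X2.CellB W p → Semistable W → (p = 3 ∨ p = 5 ∨ p = 7) → X2.MazurMainConjectureAt W p) ∧
        (∀ (W : WeierstrassCurve ℚ) [W.IsElliptic] [W.IsGloballyMinimal] (p : ℕ) [Fact p.Prime],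
          X2.CellB W p → ¬ Semistable W → X2.MazurMainConjectureAt W p)) := by
  refine ⟨fun h ↦ ⟨fun W _ _ p _ hc _ _ ↦ h W p hc, fun W _ _ p _ hc _ ↦ h W p hc⟩, fun ⟨hs, hn⟩ W _ _ p _ hc ↦ ?_⟩
  by_cases hsst : Semistable W
  · exact hs W p hc hsst (eq_or_of_cellB_of_semistable hMT hsst hc)
  · exact hn W p hc hsst

/-- **The `p = 13` slice of the crux ⟺ the same slice on NON-semistable curves** (granted `mazur_torsion`; `⟹`
unconditional): with x2-p1-w8 g7's `…PrimeSupport.mazurMCOnCellB_iff_slices` the fourth conjunct of the crux may be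
read on non-semistable `W` only. [cite: SerreInventiones1972, §5.4 Prop. 21] [cite: Mazur1978, Thm. 1 and Thm. 4] -/
theorem slice_thirteen_iff_nonSemistable (hMT : ∀ V : WeierstrassCurve ℚ, mazur_torsion V) :
    (∀ (W : WeierstrassCurve ℚ) [W.IsElliptic] [W.IsGloballyMinimal] [Fact (Nat.Prime 13)],
        X2.CellB W 13 → X2.MazurMainConjectureAt W 13) ↔
      (∀ (W : WeierstrassCurve ℚ) [W.IsElliptic] [W.IsGloballyMinimal] [Fact (Nat.Prime 13)],
        X2.CellB W 13 → ¬ Semistable W → X2.MazurMainConjectureAt W 13) :=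
  ⟨fun h W _ _ _ hc _ ↦ h W hc, fun h W _ _ _ hc ↦ h W hc (not_semistable_of_cellB_thirteen hMT hc)⟩

end Summit.BirchSwinnertonDyer.BirchSwinnertonDyer.Theorems.EisensteinPrimesMazurMCOnCellBSemistableSlice

end
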